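import Literature.NumberTheory.EllipticCurves.TateFormPrimePowerTorsionProofs
import Literature.NumberTheory.EllipticCurves.InertiaInvariantsKodairaNeronMultiplicativeProofs
import Literature.NumberTheory.EllipticCurves.NeronOggShafarevichProofs
import Literature.NumberTheory.EllipticCurves.TateModuleProjSurjectiveProofs
import HarnessLib

/-!
# `codim (V_ℓ E)^{I_𝔓} = 1` at the multiplicative places — unconditionally
# (Silverman *ATAEC* Thm. IV.10.2(a), multiplicative case, and (b), clause `p ≥ 5`, are theorems)

`Proofs` file (theorems only, no definitions, no named facts) in topic
`NumberTheory/EllipticCurves`, landed by the tenured seat of bsd.S15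
(`Literature.NumberTheory.EllipticCurves.conductorNorm_eq_artinConductorNat`, `BSDConductor`).
It **discharges three named facts** of `HasseWeilAbelianConductor`:

* `WeierstrassCurve.codimFixed_inertia_rationalTate_eq_one_of_hasMultiplicativeReductionAt W ℓ`
  (`…_holds`) — Silverman, *Advanced Topics in the Arithmetic of Elliptic Curves*, Thm. IV.10.2(a),
  multiplicative case: *"`ε(E/K) = 1` if `E` has multiplicative reduction"* (PDF p. 358 of the
  held copy), i.e. `codim (V_ℓ E)^{I_𝔓} = 1` at a place `v ∤ ℓ` of multiplicative reduction;
* `WeierstrassCurve.swanConductorAt_rationalTate_eq_zero_of_hasMultiplicativeReductionAt W ℓ`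
  (`…_holds`) — Thm. IV.10.2(b) at the multiplicative places, `δ(E/K) = 0`;
* `WeierstrassCurve.swanConductorAt_rationalTate_eq_zero_of_ringChar_ne W ℓ` (`…_holds`) —
  Thm. IV.10.2(b), clause `p ≥ 5`: `δ(E/K) = 0` at every place `v ∤ 6ℓ`;

and makes the C15 fact `artinConductorExponent_tate_eq_conductorExponent_of_isElliptic W ℓ`
(`a_v(V_ℓ E) = f_v(E)`) a theorem for **semistable** curves over number fields
(`artinConductorExponent_tate_eq_conductorExponent_of_isSemistable`), whence over `ℚ` **bsd.S15 for
semistable elliptic curves with no hypothesis left**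
(`Literature.NumberTheory.EllipticCurves.conductorNorm_eq_artinConductorNat_of_isSemistable`).

## The proof

The predecessor `InertiaInvariantsKodairaNeronMultiplicativeProofs` proved the multiplicative case
of 10.2(a) from the Kodaira–Néron finiteness (`E(K^nr)/E₀(K^nr)` finite, *ATAEC* Cor. IV.9.2(d),
*AEC* VII.6.2 — proved in neither book), following the printed proof (PDF p. 359:
`V_ℓ(E(K^nr)) ≃ V_ℓ(E₀(K^nr)) ≃ V_ℓ(Ẽ_ns(k̄)) = V_ℓ(k̄^*) ≅ ℚ_ℓ`).  Kodaira–Néron enters that proof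
at exactly one point, the first isomorphism (`c • E(K̄)^{I_𝔓} ⊆ A'`, rank comparison
`finrank_eq_of_nsmul_mem`).  Here it is dispensed with:

1. *(lower bound)* the reduction data of the predecessor — `A' = F⁻¹(E₀) ≤ E(K̄)^{I_𝔓}`,
   `r : A' → k̄^×` with uniquely `ℓ`-divisible kernel and image containing the `ℓ`-power torsion —
   give `rank_{ℤ_ℓ} T_ℓ(A') = 1`, and `T_ℓ(A') ↪ T_ℓ(E(K̄)^{I_𝔓})` (`T_ℓ` is left exact), so the
   rank of the latter is `≥ 1`
   (`TateModule.finrank_eq_one_of_reduction_of_forall_mem_range_of_finrank_le_one`);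
2. *(upper bound)* `rank_{ℤ_ℓ} T_ℓ(E(K̄)^{I_𝔓}) ≤ 1`: if it were `2`, `I_𝔓` would act trivially on
   `V_ℓ E` (`codimFixed_rationalTate_eq_zero_iff`, `ContinuousRep.codimFixed_eq_zero_iff`), hence on
   `T_ℓ E` and on every `E[ℓⁿ]` (`proj_surjective_of_isAlgClosed_holds`) —
   `finrank_tateModule_fixedPoints_le_one_of_exists_smul_ne`; but at a place of multiplicative
   reduction `|j(E)|_v > 1` (`one_lt_spectralValuation_j_of_hasMultiplicativeReductionAt`: on the
   minimal model `Δ ∈ 𝓂_v`, `c₄ ∈ 𝓞_v^×`, `jΔ = c₄³`), and then some element of the local inertia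
   group moves some `ℓ`-power torsion point (`exists_not_forall_inertia_smul_eq_prime_pow_of_one_lt_j`,
   `TateFormPrimePowerTorsionProofs`: the torsion class count on the Tate form of invariant `j`,
   Silverman, *AEC*, proof of Thm. VII.7.1, multiplicative case — for **every** prime `ℓ ∤ v`,
   `ℓ = 2` included), which transfers to `I_𝔓 ≤ Γ_K` along an embedding `K̄ → K̄_v`
   (`exists_inertia_primeBelow_smul_ne_of_not_forall`).

The main theorem `codimFixed_inertia_rationalTate_eq_one_of_hasMultiplicativeReductionAt_primeBelow`
repeats the predecessor's construction of the reduction data verbatim (models, node, `hdiv`,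
`hr`), with the Kodaira–Néron exponent removed and the final appeal made to
`codimFixed_inertia_rationalTate_eq_one_of_reduction_of_finrank_le_one`.

## Consequences (all by feeding existing reductions of the tree)

`swanConductorAt_rationalTate_eq_zero_of_hasMultiplicativeReductionAt_holds` (unipotent inertia and the
Weil pairing, `BSDConductorSemistableProofs`); `swanConductorAt_rationalTate_eq_zero_of_ringChar_ne_holds`
(`HasseWeilAbelianTameNegativeJProofs`: potential good reduction for `v(j) ≥ 0`, a quadratic twist
with multiplicative reduction for `v(j) < 0`); `codimFixed_inertia_rationalTate_eq_tameConductorExponent_of_add`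
(10.2(a) from its additive case alone); `artinConductorExponent_tate_eq_conductorExponent_of_isSemistable`;
`…_of_isElliptic_of_add_of_ringChar_eq` (C15 from the additive case of 10.2(a) and Ogg–Saito at
`p = 2, 3`); `codimFixed_inertia_rationalTate_eq_two_of_hasAdditiveReductionAt_of_kodairaNeron_additive`
(the additive case from Kodaira–Néron at the *additive* places only); over `ℚ`:
`conductorNorm_eq_artinConductorNat_of_isSemistable` (no hypothesis),
`conductorNorm_eq_artinConductorNat_of_add_of_ringChar_eq`,
`conductorNorm_eq_artinConductorNat_of_kodairaNeron_additive_of_ringChar_eq`.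

So after this file the trust base of bsd.S15 (`conductorNorm_eq_artinConductorNat W ℓ` at an
elliptic `W/ℚ`) is {Kodaira–Néron finiteness for the minimal models at the primes of **additive**
reduction (*ATAEC* IV.9.2(d)), Ogg–Saito at `p = 2, 3` (*ATAEC* 11.1)}, and for a semistable
`E/ℚ` it is empty.

All axioms `propext`, `Classical.choice`, `Quot.sound`.

## References

* J. H. Silverman, *Advanced Topics in the Arithmetic of Elliptic Curves*, GTM 151 (1994), §IV.10,
  Thm. 10.2 and its proof (PDF pp. 358–362); Cor. IV.9.2(d); Example 10.5 (p. 364); §IV.11,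
  proof of 11.1 (p. 366). [SilvermanATAEC1994]
* J. H. Silverman, *The Arithmetic of Elliptic Curves*, 2nd ed. (2009), III.§7, VII.2.1, VII.2.2,
  VII.3.1, VII.5.1(b), Thm. VII.7.1 and its proof (PDF pp. 178–179). [SilvermanAEC2009]
* J.-P. Serre, J. Tate, *Good reduction of abelian varieties*, Ann. of Math. 88 (1968), §1,
  Lemmas 1–2. [SerreTate1968]
* J. Neukirch, *Algebraic Number Theory* (1999), Ch. II §9 (9.3), (9.6). [NeukirchANT1999]

## Design

No definitions; `noncomputable section`; `open scoped Classical NNReal Pointwise AddSubgroup`; universe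
`u` for the curves (auxiliary fields `Type*`).  `set_option maxHeartbeats 800000` for the main
proof, as in the predecessor.
-/

noncomputable section

open scoped Classical NNReal

universe u

open scoped AddSubgroup Pointwise

namespace Literature.NumberTheory.EllipticCurves

namespace TateModule

variable {A : Type u} [AddCommGroup A] {p : ℕ} [Fact p.Prime] {F : Type*} [Field F]

/-- **Multiplicative shape from reduction data and an upper bound on the rank.**  If `A[p]` is
finite, `rank_{ℤ_p} T_p A ≤ 1`, and a subgroup `A' ≤ A` carries a homomorphism `r : A' →+ F^×`
(additively written, `F` separably closed with `(p : F) ≠ 0`) with uniquely `p`-divisible kernel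
and an image containing every `p`-power torsion element of `F^×`, then `rank_{ℤ_p} T_p A = 1`:
`T_p A' ≅ T_p r(A') ≅ T_p F^× ≅ ℤ_p` (`finrank_eq_of_surjective_of_ker`,
`map_bijective_of_injective_of_forall_mem_range`, `finrank_tateModule_additive_units`) injects
into `T_p A` (`T_p` is left exact).  Variant of `finrank_eq_one_of_reduction_of_forall_mem_range`
in which the finite-index hypothesis `c • A ⊆ A'` (Kodaira–Néron) is traded for the upper bound.
Silverman, *ATAEC*, proof of Thm. IV.10.2(a), PDF p. 359 (`V_ℓ(E₀(K^nr)) ≅ V_ℓ(k̄^*) ≅ ℚ_ℓ`).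
[cite: SilvermanATAEC1994, proof of Thm. IV.10.2(a), PDF p. 359] -/
theorem finrank_eq_one_of_reduction_of_forall_mem_range_of_finrank_le_one [IsSepClosed F]
    (hfin : Finite (A[(p : ℕ)])) (A' : AddSubgroup A)
    (hle : Module.finrank ℤ_[p] (TateModule A p) ≤ 1) (hp : (p : F) ≠ 0)
    (r : A' →+ Additive Fˣ)
    (hr : ∀ b : Additive Fˣ, ∀ n : ℕ, p ^ n • b = 0 → b ∈ r.range)
    (htf : ∀ a : A', r a = 0 → p • a = 0 → a = 0)
    (hdiv : ∀ a : A', r a = 0 → ∃ b : A', r b = 0 ∧ p • b = a) :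
    Module.finrank ℤ_[p] (TateModule A p) = 1 := by
  haveI := finite_of_finite_torsionBy hfin
  -- corestriction of `r` to its image `B`
  set B : AddSubgroup (Additive Fˣ) := r.range with hB
  set r' : A' →+ B := r.rangeRestrict with hr'
  have hr'0 : ∀ a : A', r' a = 0 ↔ r a = 0 := fun a ↦ by
    rw [hr', ← Subtype.coe_inj, AddMonoidHom.coe_rangeRestrict, AddSubgroup.coe_zero]
  have h1 : Module.finrank ℤ_[p] (TateModule A' p) = Module.finrank ℤ_[p] (TateModule B p) := by
    refine finrank_eq_of_surjective_of_ker r' (AddMonoidHom.rangeRestrict_surjective r)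
      (fun a ha ↦ htf a ((hr'0 a).mp ha)) (fun a ha ↦ ?_)
    obtain ⟨b, hb, hba⟩ := hdiv a ((hr'0 a).mp ha)
    exact ⟨b, (hr'0 b).mpr hb, hba⟩
  have h2 : Module.finrank ℤ_[p] (TateModule B p) =
      Module.finrank ℤ_[p] (TateModule (Additive Fˣ) p) :=
    (LinearEquiv.ofBijective (map p B.subtype)
      (map_bijective_of_injective_of_forall_mem_range B.subtype Subtype.val_injective
        (fun b n hb ↦ ⟨⟨b, hr b n hb⟩, rfl⟩))).finrank_eq
  have hA' : Module.finrank ℤ_[p] (TateModule A' p) = 1 := by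
    rw [h1, h2, finrank_tateModule_additive_units p hp]
  -- `T_p A' ↪ T_p A`
  have hinj : Function.Injective (map p A'.subtype) := fun x y hxy ↦
    TateModule.ext fun n ↦ Subtype.val_injective (by
      have := congrArg (proj p n) hxy
      rwa [proj_map, proj_map] at this)
  have hge : 1 ≤ Module.finrank ℤ_[p] (TateModule A p) := by
    rw [← hA', ← LinearMap.finrank_range_of_inj hinj]
    exact Submodule.finrank_le _
  omega

end TateModule

end Literature.NumberTheory.EllipticCurves

namespace WeierstrassCurve

open Literature.NumberTheory.EllipticCurves Literature.NumberTheory.GaloisRepresentations Field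
  IsDedekindDomain.HeightOneSpectrum NumberField IsDedekindDomain

section AnyField

variable {F : Type u} [Field F] (W : WeierstrassCurve F) (ℓ : ℕ) [Fact ℓ.Prime]
  {k : Type*} [Field k]

/-- **Multiplicative shape, any subgroup, from reduction data and the upper bound.**  For an
elliptic curve `E/F`, `ℓ ≠ char F`, `H ≤ Γ_F`: if `rank_{ℤ_ℓ} T_ℓ(E(F̄)^H) ≤ 1` and `E(F̄)^H` has a
subgroup `A'` with a homomorphism `r` to the multiplicative group of a separably closed field of
characteristic `≠ ℓ` with uniquely `ℓ`-divisible kernel whose image contains all `ℓ`-power roots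
of unity, then `codim (V_ℓ E)^H = 1`.  Silverman *ATAEC*, proof of IV.10.2(a), PDF p. 359.
[cite: SilvermanATAEC1994, proof of Thm. IV.10.2(a), PDF p. 359] -/
theorem codimFixed_rationalTate_eq_one_of_reduction_of_finrank_le_one' [W.IsElliptic]
    [IsSepClosed k] (hℓ : (ℓ : F) ≠ 0) (hℓk : (ℓ : k) ≠ 0)
    (h : Continuous fun x : absoluteGaloisGroup F × RationalTateModule (geomPoints W) ℓ ↦
      rationalTateRepresentation (absoluteGaloisGroup F) (geomPoints W) ℓ x.1 x.2)
    (H : Subgroup (absoluteGaloisGroup F))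
    (A' : AddSubgroup (FixedPoints.addSubgroup H (geomPoints W)))
    (hle : Module.finrank ℤ_[ℓ] (TateModule (FixedPoints.addSubgroup H (geomPoints W)) ℓ) ≤ 1)
    (r : A' →+ Additive kˣ)
    (hr : ∀ b : Additive kˣ, ∀ n : ℕ, ℓ ^ n • b = 0 → b ∈ r.range)
    (htf : ∀ P : A', r P = 0 → ℓ • P = 0 → P = 0)
    (hdiv : ∀ P : A', r P = 0 → ∃ Q : A', r Q = 0 ∧ ℓ • Q = P) :
    (rationalTateGaloisRepOf (geomPoints W) ℓ h).codimFixed H = 1 := by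
  refine (W.codimFixed_rationalTate_eq_one_iff ℓ hℓ h H).mpr ?_
  have hfin : Finite ((FixedPoints.addSubgroup H (geomPoints W))[(ℓ : ℕ)]) :=
    finite_torsionBy_of_injective (FixedPoints.addSubgroup H (geomPoints W)).subtype
      (fun _ _ h ↦ Subtype.ext h) _ (W.finite_geomTorsion_prime ℓ)
  exact TateModule.finrank_eq_one_of_reduction_of_forall_mem_range_of_finrank_le_one hfin A' hle
    hℓk r hr htf hdiv

/-- **The upper bound from ramified torsion.**  For an elliptic curve `E/F`, `ℓ ≠ char F` and
`H ≤ Γ_F`: if some `σ ∈ H` moves some `ℓ`-power torsion point of `E(F̄)`, then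
`rank_{ℤ_ℓ} T_ℓ(E(F̄)^H) ≤ 1`.  For otherwise the rank is `2` (`finrank_tateModule_fixedPoints_le_two`),
`codim (V_ℓ E)^H = 0` (`codimFixed_rationalTate_eq_zero_iff`), `H` acts trivially on `V_ℓ E`
(`ContinuousRep.codimFixed_eq_zero_iff`), hence on `T_ℓ E ⊆ V_ℓ E`
(`galoisRepTate_eq_one_of_rationalGaloisRepTate_eq_one`), hence on every `E[ℓⁿ]`, onto which
`T_ℓ E` projects (`proj_surjective_of_isAlgClosed_holds`, *AEC* III.§7).  Silverman, *AEC*, proof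
of Thm. VII.7.1 ((c) ⇒ (d): "`T_ℓ(E)` is unramified iff `E[ℓⁿ]` is unramified for all `n`").
[cite: SilvermanAEC2009, Thm. VII.7.1 (proof, (c) ⇒ (d)) with III.§7] -/
theorem finrank_tateModule_fixedPoints_le_one_of_exists_smul_ne [W.IsElliptic] (hℓ : (ℓ : F) ≠ 0)
    (h : Continuous fun x : absoluteGaloisGroup F × RationalTateModule (geomPoints W) ℓ ↦
      rationalTateRepresentation (absoluteGaloisGroup F) (geomPoints W) ℓ x.1 x.2)
    (H : Subgroup (absoluteGaloisGroup F))
    (hex : ∃ σ ∈ H, ∃ P : geomPoints W, (∃ n : ℕ, ℓ ^ n • P = 0) ∧ σ • P ≠ P) :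
    Module.finrank ℤ_[ℓ] (TateModule (FixedPoints.addSubgroup H (geomPoints W)) ℓ) ≤ 1 := by
  by_contra hlt
  have h2 : Module.finrank ℤ_[ℓ] (TateModule (FixedPoints.addSubgroup H (geomPoints W)) ℓ) = 2 :=
    le_antisymm (W.finrank_tateModule_fixedPoints_le_two ℓ hℓ H) (by omega)
  have h0 := (W.codimFixed_rationalTate_eq_zero_iff ℓ hℓ h H).mpr h2
  haveI : Module.Finite ℚ_[ℓ] (RationalTateModule (geomPoints W) ℓ) := W.finite_rationalTateModule ℓ
  rw [ContinuousRep.codimFixed_eq_zero_iff] at h0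
  obtain ⟨σ, hσ, P, ⟨n, hn⟩, hne⟩ := hex
  apply hne
  have h1 : W.rationalGaloisRepTate ℓ σ = 1 := h0 σ hσ
  have h1' := W.galoisRepTate_eq_one_of_rationalGaloisRepTate_eq_one ℓ h1
  obtain ⟨a, rfl⟩ := W.proj_surjective_of_isAlgClosed_holds ℓ n (P := P)
    ((Submodule.mem_torsionBy_iff _ _).mpr (by rw [natCast_zsmul, hn]))
  rw [← TateModule.proj_smul_of_distribMulAction, ← galoisRepTate_apply_apply, h1',
    Module.End.one_apply]

/-- `j · Δ = c₄³` for an elliptic curve (`j = c₄³/Δ`). [folklore] -/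
theorem j_mul_Δ_eq_c₄_pow {R : Type*} [CommRing R] (E : WeierstrassCurve R) [E.IsElliptic] :
    E.j * E.Δ = E.c₄ ^ 3 := by
  rw [WeierstrassCurve.j, ← coe_Δ', mul_comm, ← mul_assoc, Units.mul_inv, one_mul]

end AnyField

section NumberField

variable {K : Type u} [Field K] [NumberField K] (W : WeierstrassCurve K) (ℓ : ℕ) [Fact ℓ.Prime]
  {k : Type*} [Field k]

/-- **Multiplicative case of *ATAEC* IV.10.2(a) from reduction data at `𝔓` and the upper bound**
(variant of `codimFixed_inertia_rationalTate_eq_one_of_reduction'` with Kodaira–Néron's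
`c • E(K̄)^{I_𝔓} ⊆ A'` replaced by `rank T_ℓ(E(K̄)^{I_𝔓}) ≤ 1`): `codim_{ℚ_ℓ} (V_ℓ E)^{I_𝔓} = 1`.
[cite: SilvermanATAEC1994, proof of Thm. IV.10.2(a), PDF p. 359] -/
theorem codimFixed_inertia_rationalTate_eq_one_of_reduction_of_finrank_le_one [W.IsElliptic]
    [IsSepClosed k] (hℓk : (ℓ : k) ≠ 0)
    (h : Continuous fun x : absoluteGaloisGroup K × RationalTateModule (geomPoints W) ℓ ↦
      rationalTateRepresentation (absoluteGaloisGroup K) (geomPoints W) ℓ x.1 x.2)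
    (𝔓 : Ideal (absIntegers (𝓞 K) K))
    (A' : AddSubgroup (FixedPoints.addSubgroup (𝔓.inertia (absoluteGaloisGroup K)) (geomPoints W)))
    (hle : Module.finrank ℤ_[ℓ]
        (TateModule (FixedPoints.addSubgroup (𝔓.inertia (absoluteGaloisGroup K)) (geomPoints W)) ℓ)
      ≤ 1)
    (r : A' →+ Additive kˣ)
    (hr : ∀ b : Additive kˣ, ∀ n : ℕ, ℓ ^ n • b = 0 → b ∈ r.range)
    (htf : ∀ P : A', r P = 0 → ℓ • P = 0 → P = 0)
    (hdiv : ∀ P : A', r P = 0 → ∃ Q : A', r Q = 0 ∧ ℓ • Q = P) :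
    (rationalTateGaloisRepOf (geomPoints W) ℓ h).codimFixed (𝔓.inertia (absoluteGaloisGroup K)) =
      1 :=
  W.codimFixed_rationalTate_eq_one_of_reduction_of_finrank_le_one' ℓ
    (by exact_mod_cast (Fact.out : ℓ.Prime).ne_zero) hℓk h _ A' hle r hr htf hdiv

variable {v : HeightOneSpectrum (𝓞 K)}

/-- **From local to global ramified torsion.**  If some `σ ∈ I_𝔐 ≤ Γ_{K_v}` moves some
`ℓᵏ`-torsion point of `E(K̄_v)`, then for any `K`-embedding `ι : K̄ → K̄_v` the element
`σ|_K̄ ∈ I_{𝔓_{ι,𝔐}} ≤ Γ_K` (`resGalOfEmb_mem_inertia_primeBelow`) moves some `ℓ`-power torsion point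
of `E(K̄)`: all torsion of `E(K̄_v)` comes from `E(K̄)` (`exists_pointsMapOfEmb_eq_of_nsmul_eq_zero`)
and `ι_*` is equivariant (`pointsMapOfEmb_smul`).  Silverman, *AEC*, VIII.§1, X.§4. [folklore] -/
theorem exists_inertia_primeBelow_smul_ne_of_not_forall [W.IsElliptic]
    (ι : AlgebraicClosure K →ₐ[K] AlgebraicClosure (v.adicCompletion K))
    (𝔐 : Ideal v.localAbsIntegers) {ℓ : ℕ} (hℓ : ℓ ≠ 0) {k : ℕ}
    (hloc : ¬ ∀ σ ∈ 𝔐.inertia (absoluteGaloisGroup (v.adicCompletion K)),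
        ∀ P : localPoints W (v.adicCompletion K), ℓ ^ k • P = 0 → σ • P = P) :
    ∃ σ ∈ (v.primeBelow ι 𝔐).inertia (absoluteGaloisGroup K), ∃ P : geomPoints W,
      (∃ n : ℕ, ℓ ^ n • P = 0) ∧ σ • P ≠ P := by
  push Not at hloc
  obtain ⟨σ, hσ, Q, hQ, hne⟩ := hloc
  obtain ⟨P, hP, rfl⟩ := exists_pointsMapOfEmb_eq_of_nsmul_eq_zero W ι (pow_ne_zero k hℓ) hQ
  refine ⟨resGalOfEmb ι σ, v.resGalOfEmb_mem_inertia_primeBelow ι 𝔐 hσ, P, ⟨k, hP⟩,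
    fun heq ↦ hne ?_⟩
  rw [← pointsMapOfEmb_smul, heq]

/-- **`|j(E)|_v > 1` at a place of multiplicative reduction** (Silverman, *AEC*, Prop. VII.5.1(b):
multiplicative reduction iff `v(Δ) > 0`, `v(c₄) = 0` for a minimal equation, whence
`v(j) = 3v(c₄) - v(Δ) < 0`), for the spectral valuation `|·|_v` of `K̄_v`: on the local minimal
model `X` at `v`, `Δ ∈ 𝓂_v` and `c₄ ∈ 𝓞_vˣ` (Mathlib `HasMultiplicativeReduction`), and
`j · Δ = c₄³` with `j = j(E)` (`j` is a `K̄`-isomorphism invariant), so `j ∈ 𝓞_v` is absurd.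
[cite: SilvermanAEC2009, Prop. VII.5.1(b)] -/
theorem one_lt_spectralValuation_j_of_hasMultiplicativeReductionAt [W.IsElliptic]
    {w : Valuation (AlgebraicClosure (v.adicCompletion K)) ℝ≥0}
    (hw : ∀ x, (w x : ℝ) =
      spectralNorm (v.adicCompletion K) (AlgebraicClosure (v.adicCompletion K)) x)
    (hmult : W.HasMultiplicativeReductionAt v) :
    1 < w (algebraMap K (AlgebraicClosure (v.adicCompletion K)) W.j) := by
  rw [IsScalarTower.algebraMap_apply K (v.adicCompletion K) (AlgebraicClosure (v.adicCompletion K))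
    W.j, ← not_le, spectralValuation_algebraMap_le_one_iff hw]
  intro hjint
  haveI : (W.localMinimalModel v).IsElliptic := W.isElliptic_localMinimalModel v
  have hm : (W.localMinimalModel v).HasMultiplicativeReduction (v.adicCompletionIntegers K) := hmult
  obtain ⟨C, hC⟩ := W.exists_variableChange_smul_eq_localMinimalModel v
  -- `j(E) · Δ_X = c₄(X)³`
  have key : algebraMap K (v.adicCompletion K) W.j * (W.localMinimalModel v).Δ =
      (W.localMinimalModel v).c₄ ^ 3 := by
    have hj' : (C • W.baseChange (v.adicCompletion K)).j = algebraMap K (v.adicCompletion K) W.j := by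
      rw [variableChange_j]
      exact W.map_j _
    rw [← hC, ← hj']
    exact (C • W.baseChange (v.adicCompletion K)).j_mul_Δ_eq_c₄_pow
  -- valuations
  have hjle : IsDedekindDomain.HeightOneSpectrum.valuation (v.adicCompletion K)
      (IsDiscreteValuationRing.maximalIdeal (v.adicCompletionIntegers K))
      (algebraMap K (v.adicCompletion K) W.j) ≤ 1 :=
    IsDedekindDomain.HeightOneSpectrum.valuation_le_one _
      (⟨algebraMap K (v.adicCompletion K) W.j, hjint⟩ : v.adicCompletionIntegers K)
  have hlt := hm.badReduction
  have hc₄ := hm.multiplicativeReduction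
  have h1 : IsDedekindDomain.HeightOneSpectrum.valuation (v.adicCompletion K)
      (IsDiscreteValuationRing.maximalIdeal (v.adicCompletionIntegers K))
      ((W.localMinimalModel v).c₄ ^ 3) < 1 := by
    rw [← key, map_mul]
    calc _ ≤ IsDedekindDomain.HeightOneSpectrum.valuation (v.adicCompletion K)
          (IsDiscreteValuationRing.maximalIdeal (v.adicCompletionIntegers K))
          (W.localMinimalModel v).Δ := mul_le_of_le_one_left' hjle
      _ < 1 := hlt
  rw [map_pow, hc₄, one_pow] at h1
  exact lt_irrefl _ h1

set_option maxHeartbeats 800000 in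
/-- **Silverman *ATAEC* Thm. IV.10.2(a), multiplicative case, unconditionally — at the prime cut
out by an embedding.**  For an elliptic curve `E/K` over a number field, a prime `ℓ`, a place
`v ∤ ℓ` of multiplicative reduction, a `K`-embedding `ι : K̄ → K̄_v` and the prime `𝔐` of
`\bar 𝓞_v` above `𝓂_v`: `codim (V_ℓ E)^{I_{𝔓_{ι,𝔐}}} = 1`.  The proof is that of
`codimFixed_inertia_rationalTate_eq_one_of_hasMultiplicativeReductionAt_of_kodairaNeron_primeBelow`
(`InertiaInvariantsKodairaNeronMultiplicativeProofs`: the reduction data `A' = F⁻¹(E₀)`,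
`r : A' → k̄^×` onto the `ℓ`-power torsion, uniquely `ℓ`-divisible kernel — Silverman's
`V_ℓ(E₀(K^nr)) ≅ V_ℓ(k̄^*) ≅ ℚ_ℓ`, PDF p. 359), except that the Kodaira–Néron input
`c • E(K̄)^{I_𝔓} ⊆ A'` (finiteness of `E(K^nr)/E₀(K^nr)`, *ATAEC* IV.9.2(d), not proved in the
book) is **not used**: `T_ℓ(A') ↪ T_ℓ(E(K̄)^{I_𝔓})` gives `rank ≥ 1`, and `rank ≤ 1` because some
element of `I_𝔓` moves some `ℓ`-power torsion point
(`finrank_tateModule_fixedPoints_le_one_of_exists_smul_ne`), which at a place with `|j|_v > 1`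
(`one_lt_spectralValuation_j_of_hasMultiplicativeReductionAt`) is the torsion class count on the Tate
form of invariant `j` (`exists_not_forall_inertia_smul_eq_prime_pow_of_one_lt_j`; Silverman, *AEC*,
proof of Thm. VII.7.1, multiplicative case).
[cite: SilvermanATAEC1994, Thm. IV.10.2(a), multiplicative case, and its proof (PDF pp. 358–359)]
[cite: SilvermanAEC2009, Thm. VII.7.1 (proof, multiplicative case)] [cite: SerreTate1968, §1 Lemma 2] -/
theorem codimFixed_inertia_rationalTate_eq_one_of_hasMultiplicativeReductionAt_primeBelow
    [W.IsElliptic]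
    (h : Continuous fun x : absoluteGaloisGroup K × RationalTateModule (geomPoints W) ℓ ↦
      rationalTateRepresentation (absoluteGaloisGroup K) (geomPoints W) ℓ x.1 x.2)
    (hℓ : (ℓ : 𝓞 K) ∉ v.asIdeal) (hmult : W.HasMultiplicativeReductionAt v)
    (ι : AlgebraicClosure K →ₐ[K] AlgebraicClosure (v.adicCompletion K))
    {𝔐 : Ideal v.localAbsIntegers} (h𝔐 : 𝔐 ∈ v.localPrimesAbove) :
    (rationalTateGaloisRepOf (geomPoints W) ℓ h).codimFixed
      ((v.primeBelow ι 𝔐).inertia (absoluteGaloisGroup K)) = 1 := by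
  obtain ⟨w, hw⟩ := v.exists_spectralValuation
  have hv0 : w.Integers w.integer := Valuation.integer.integers w
  haveI := henselianRing_integer w
  haveI := isAlgClosed_residueField_integer w
  -- models
  haveI : (W.localMinimalModel v).IsElliptic := W.isElliptic_localMinimalModel v
  have hint : ((W.localMinimalModel v).baseChange (AlgebraicClosure (v.adicCompletion K))).IsIntegral
      w.integer := by
    have := isIntegral_spectralValuation_baseChange hw
      ((W.localMinimalModel v).integralModel (v.adicCompletionIntegers K))
    rwa [show ((W.localMinimalModel v).integralModel (v.adicCompletionIntegers K)).map
        (algebraMap (v.adicCompletionIntegers K) (v.adicCompletion K)) = W.localMinimalModel v from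
      baseChange_integralModel_eq (v.adicCompletionIntegers K) (W.localMinimalModel v)] at this
  haveI := hint
  obtain ⟨W₀, hW₀⟩ := hint.integral
  -- the reduction of `W₀` is a node
  have hΔeq : algebraMap w.integer (AlgebraicClosure (v.adicCompletion K)) W₀.Δ =
      algebraMap (v.adicCompletion K) (AlgebraicClosure (v.adicCompletion K))
        (algebraMap (v.adicCompletionIntegers K) (v.adicCompletion K)
          ((W.localMinimalModel v).integralModel (v.adicCompletionIntegers K)).Δ) := by
    rw [integralModel_Δ_eq, ← map_Δ, ← map_Δ]
    change (W₀.baseChange (AlgebraicClosure (v.adicCompletion K))).Δ =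
      ((W.localMinimalModel v).baseChange (AlgebraicClosure (v.adicCompletion K))).Δ
    rw [hW₀]
  have hc₄eq : algebraMap w.integer (AlgebraicClosure (v.adicCompletion K)) W₀.c₄ =
      algebraMap (v.adicCompletion K) (AlgebraicClosure (v.adicCompletion K))
        (algebraMap (v.adicCompletionIntegers K) (v.adicCompletion K)
          ((W.localMinimalModel v).integralModel (v.adicCompletionIntegers K)).c₄) := by
    rw [integralModel_c₄_eq, ← map_c₄, ← map_c₄]
    change (W₀.baseChange (AlgebraicClosure (v.adicCompletion K))).c₄ =
      ((W.localMinimalModel v).baseChange (AlgebraicClosure (v.adicCompletion K))).c₄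
    rw [hW₀]
  have hΔ : IsLocalRing.residue w.integer W₀.Δ = 0 := by
    have hlt := (show (W.localMinimalModel v).HasMultiplicativeReduction
      (v.adicCompletionIntegers K) from hmult).badReduction
    rw [← integralModel_Δ_eq (v.adicCompletionIntegers K) (W.localMinimalModel v)] at hlt
    have hmem := (IsDedekindDomain.HeightOneSpectrum.valuation_lt_one_iff_mem _ _).mp hlt
    rw [← v_algebraMap_lt_one_iff hv0, hΔeq]
    exact spectralValuation_algebraMap_lt_one_of_mem_maximalIdeal hw h𝔐 hmem
  have hc₄ : IsLocalRing.residue w.integer W₀.c₄ ≠ 0 := by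
    have heq := (show (W.localMinimalModel v).HasMultiplicativeReduction
      (v.adicCompletionIntegers K) from hmult).multiplicativeReduction
    rw [← integralModel_c₄_eq (v.adicCompletionIntegers K) (W.localMinimalModel v)] at heq
    have hnot : ((W.localMinimalModel v).integralModel (v.adicCompletionIntegers K)).c₄ ∉
        IsLocalRing.maximalIdeal (v.adicCompletionIntegers K) := fun hmem ↦ by
      have := (IsDedekindDomain.HeightOneSpectrum.valuation_lt_one_iff_mem
        (K := v.adicCompletion K)
        (IsDiscreteValuationRing.maximalIdeal (v.adicCompletionIntegers K)) _).mpr hmem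
      rw [heq] at this
      exact lt_irrefl _ this
    have hunit : IsUnit ((W.localMinimalModel v).integralModel (v.adicCompletionIntegers K)).c₄ := by
      by_contra hu
      exact hnot ((IsLocalRing.mem_maximalIdeal _).mpr hu)
    rw [← v_algebraMap_eq_one_iff hv0, hc₄eq]
    exact spectralValuation_eq_one_of_isUnit hw hunit
  obtain ⟨rn, hrn_surj, hrn⟩ := W₀.exists_addMonoidHom_units_of_node_of_isAlgClosed hv0 hΔ hc₄
  -- transport and the Kodaira–Néron exponent
  obtain ⟨C, hC⟩ := W.exists_variableChange_smul_eq_localMinimalModel v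
  obtain ⟨Φ, hΦ⟩ := W.exists_addEquiv_localPoints_of_smul_eq v hC
  set H := (v.primeBelow ι 𝔐).inertia (absoluteGaloisGroup K) with hH
  -- **upper bound** `rank T_ℓ(E(K̄)^{I_𝔓}) ≤ 1`: not all the `ℓ`-power torsion is fixed by `I_𝔓`
  -- (`|j|_v > 1`; torsion class count on the Tate form of invariant `j`, all primes `ℓ`)
  have hle : Module.finrank ℤ_[ℓ] (TateModule (FixedPoints.addSubgroup H (geomPoints W)) ℓ) ≤ 1 := by
    obtain ⟨k, hk⟩ := W.exists_not_forall_inertia_smul_eq_prime_pow_of_one_lt_j hw h𝔐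
      (W.one_lt_spectralValuation_j_of_hasMultiplicativeReductionAt hw hmult) (Fact.out) hℓ
    exact W.finrank_tateModule_fixedPoints_le_one_of_exists_smul_ne ℓ
      (by exact_mod_cast (Fact.out : ℓ.Prime).ne_zero) h H
      (W.exists_inertia_primeBelow_smul_ne_of_not_forall ι 𝔐 (Fact.out : ℓ.Prime).ne_zero hk)
  let F : FixedPoints.addSubgroup H (geomPoints W) →+
      (W₀.baseChange (AlgebraicClosure (v.adicCompletion K))).toAffine.Point :=
    (Affine.Point.congrEquiv hW₀).toAddMonoidHom.comp
      (Φ.toAddMonoidHom.comp ((pointsMapOfEmb W ι).comp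
        (FixedPoints.addSubgroup H (geomPoints W)).subtype))
  have hFapply : ∀ P : FixedPoints.addSubgroup H (geomPoints W),
      F P = Affine.Point.congrEquiv hW₀ (Φ (pointsMapOfEmb W ι (P : geomPoints W))) := fun _ ↦ rfl
  have hFinj : Function.Injective F := fun P Q hPQ ↦ by
    rw [hFapply, hFapply] at hPQ
    exact Subtype.ext (pointsMapOfEmb_injective W ι (Φ.injective
      ((Affine.Point.congrEquiv hW₀).injective hPQ)))
  let A' : AddSubgroup (FixedPoints.addSubgroup H (geomPoints W)) :=
    (W₀.nonsingularReductionSubgroup hv0).comap F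
  have hA'mem : ∀ P, P ∈ A' ↔ W₀.HasNonsingularReduction (F P) := fun _ ↦ Iff.rfl
  let F' : A' →+ W₀.nonsingularReductionSubgroup hv0 :=
    (F.comp A'.subtype).codRestrict _ (fun P ↦ P.2)
  have hF'coe : ∀ P : A', (F' P : (W₀.baseChange (AlgebraicClosure (v.adicCompletion K))).toAffine.Point)
      = F P := fun _ ↦ rfl
  let r : A' →+ Additive (IsLocalRing.ResidueField w.integer)ˣ := rn.comp F'
  have hrapply : ∀ P : A', r P = rn (F' P) := fun _ ↦ rfl
  have hℓw : w ((ℓ : ℤ) : AlgebraicClosure (v.adicCompletion K)) = 1 :=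
    spectralValuation_intCast_eq_one hw (n := (ℓ : ℤ)) (by simpa using hℓ)
  have hℓnw : ∀ n : ℕ, w (((ℓ ^ n : ℕ) : ℤ) : AlgebraicClosure (v.adicCompletion K)) = 1 := fun n ↦
    spectralValuation_intCast_eq_one hw (n := ((ℓ ^ n : ℕ) : ℤ))
      (by simpa using v.natCast_pow_not_mem hℓ n)
  have htf : ∀ P : A', r P = 0 → ℓ • P = 0 → P = 0 := by
    intro P hr0 hℓP
    have h0 : W₀.ReducesToZero (F P) := (hrn (F' P)).mp hr0
    have hℓF : (ℓ : ℤ) • F P = 0 := by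
      rw [natCast_zsmul, ← map_nsmul, ← AddSubgroup.coe_nsmul, hℓP, AddSubgroup.coe_zero, map_zero]
    have hF0 : F P = 0 := h0.eq_zero_of_zsmul_eq_zero W₀ hℓw hℓF
    have hP0 : (P : FixedPoints.addSubgroup H (geomPoints W)) = 0 := hFinj (by rw [hF0, map_zero])
    exact Subtype.ext hP0
  have hℓk : ((ℓ : ℕ) : IsLocalRing.ResidueField w.integer) ≠ 0 := by
    have hℓw' : w (algebraMap w.integer (AlgebraicClosure (v.adicCompletion K)) (ℓ : w.integer)) = 1 := by
      rw [map_natCast]; exact_mod_cast hℓw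
    have h1 : IsLocalRing.residue w.integer (ℓ : w.integer) ≠ 0 :=
      (v_algebraMap_eq_one_iff hv0 _).mp hℓw'
    simpa using h1
  -- inertia elements of `Γ_K` at `𝔓_{ι,𝔐}` lift to `I_𝔐` (Neukirch II (9.6))
  have hlift : ∀ {σ : absoluteGaloisGroup K}, σ ∈ H →
      ∃ τ ∈ 𝔐.inertia (absoluteGaloisGroup (v.adicCompletion K)), resGalOfEmb ι τ = σ := by
    intro σ hσ
    obtain ⟨τ, hτI, hτ⟩ := exists_mem_inertia_apply_eq_holds v ι h𝔐 hσ
    exact ⟨τ, hτI, resGalOfEmb_eq_of_apply_eq ι hτ⟩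
  -- two points of `E₁`, resp. of `E₀` killed by `ℓ^n`, with ... : a point of `X(K̄_v)` in `E₁`
  -- (resp. torsion in `E₀`) whose `ℓ`-multiple (resp. reduction) is `I_𝔐`-invariant is `I_𝔐`-fixed
  -- **hdiv**
  have hdiv : ∀ P : A', r P = 0 → ∃ Q : A', r Q = 0 ∧ ℓ • Q = P := by
    intro P hr0
    have h0 : W₀.ReducesToZero (F P) := (hrn (F' P)).mp hr0
    -- name the geometric point under `P`
    set Pg : geomPoints W := ((P : FixedPoints.addSubgroup H (geomPoints W)) : geomPoints W) with hPg
    have hPgfix : ∀ σ ∈ H, σ • Pg = Pg := fun σ hσ ↦ (P : FixedPoints.addSubgroup H (geomPoints W)).2 ⟨σ, hσ⟩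
    have hFP : F P = Affine.Point.congrEquiv hW₀ (Φ (pointsMapOfEmb W ι Pg)) := hFapply _
    rcases hR : Φ (pointsMapOfEmb W ι Pg) with _ | ⟨x, y, hxy⟩
    · -- `P = 0`
      refine ⟨0, map_zero r, ?_⟩
      have hF0 : F P = 0 := by
        rw [hFP, hR, ← Affine.Point.zero_def, map_zero]
      have hP0 : (P : FixedPoints.addSubgroup H (geomPoints W)) = 0 := hFinj (by rw [hF0, map_zero])
      rw [smul_zero]
      exact (Subtype.ext hP0).symm
    · -- `Φ ι_* P = (x, y)` with `w x > 1`
      have hx : 1 < w x := by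
        rw [hFP, hR, Affine.Point.congrEquiv_some, reducesToZero_some_iff, not_mem_range_iff hv0] at h0
        exact h0
      obtain ⟨x', y', hxy', hx', hdivpt⟩ := exists_zsmul_eq_of_one_lt_val (w := w)
        (V := (W.localMinimalModel v).baseChange (AlgebraicClosure (v.adicCompletion K)))
        (m := (ℓ : ℤ)) hℓw hxy hx
      set R' : ((W.localMinimalModel v).baseChange (AlgebraicClosure (v.adicCompletion K))).toAffine.Point :=
        .some x' y' hxy' with hR'
      have hR'E₁ : W₀.ReducesToZero (Affine.Point.congrEquiv hW₀ R') := by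
        rw [hR', Affine.Point.congrEquiv_some, reducesToZero_some_iff, not_mem_range_iff hv0]
        exact hx'
      have hℓR' : (ℓ : ℤ) • R' = Φ (pointsMapOfEmb W ι Pg) := by rw [hR', hdivpt, hR]
      -- lift `R'` to `E(K̄)`
      obtain ⟨Q₀, hQ₀⟩ := W.zsmul_geomPoints_surjective_holds (n := (ℓ : ℤ))
        (by exact_mod_cast (Fact.out : ℓ.Prime).ne_zero) Pg
      have hQ₀' : (ℓ : ℤ) • Q₀ = Pg := hQ₀
      have htors : ℓ • (Φ.symm R' - pointsMapOfEmb W ι Q₀) = 0 := by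
        rw [nsmul_sub, ← natCast_zsmul, ← natCast_zsmul, ← map_zsmul, hℓR',
          AddEquiv.symm_apply_apply, ← map_zsmul, hQ₀', sub_self]
      obtain ⟨T₀, -, hT₀⟩ := exists_pointsMapOfEmb_eq_of_nsmul_eq_zero W ι
        (Fact.out : ℓ.Prime).ne_zero htors
      set Q' : geomPoints W := Q₀ + T₀ with hQ'
      have hιQ' : pointsMapOfEmb W ι Q' = Φ.symm R' := by
        rw [hQ', map_add, hT₀]; abel
      have hΦιQ' : Φ (pointsMapOfEmb W ι Q') = R' := by rw [hιQ', AddEquiv.apply_symm_apply]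
      -- `Q'` is fixed by `I_𝔓`
      have hQ'fix : ∀ σ ∈ H, σ • Q' = Q' := by
        intro σ hσ
        obtain ⟨τ, hτI, hres⟩ := hlift hσ
        obtain ⟨hτ₁, -⟩ := isometry_of_mem_inertia hw h𝔐 hτI
        apply pointsMapOfEmb_injective W ι
        rw [← hres, pointsMapOfEmb_smul, hιQ']
        apply Φ.injective
        rw [hΦ τ, AddEquiv.apply_symm_apply]
        -- both sides are `ℓ`-division points of `Φ ι_* P` lying in `E₁`
        have hτR'E₁ : W₀.ReducesToZero (Affine.Point.congrEquiv hW₀ (Affine.Point.map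
            ((absoluteGaloisGroup.toAlgEquiv _ τ :
              AlgebraicClosure (v.adicCompletion K) ≃ₐ[v.adicCompletion K]
                AlgebraicClosure (v.adicCompletion K)) :
              AlgebraicClosure (v.adicCompletion K) →ₐ[v.adicCompletion K]
                AlgebraicClosure (v.adicCompletion K)) R')) :=
          (W₀.reducesToZero_congrEquiv_map_iff hW₀ _ hτ₁ R').mpr hR'E₁
        have hℓτR' : (ℓ : ℤ) • Affine.Point.map ((absoluteGaloisGroup.toAlgEquiv _ τ :
              AlgebraicClosure (v.adicCompletion K) ≃ₐ[v.adicCompletion K]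
                AlgebraicClosure (v.adicCompletion K)) :
              AlgebraicClosure (v.adicCompletion K) →ₐ[v.adicCompletion K]
                AlgebraicClosure (v.adicCompletion K)) R' = Φ (pointsMapOfEmb W ι Pg) := by
          rw [← map_zsmul, hℓR', ← hΦ τ, ← pointsMapOfEmb_smul, hres, hPgfix σ hσ]
        have hdiff := (W₀.kernelOfReduction hv0).sub_mem hτR'E₁ hR'E₁
        rw [mem_kernelOfReduction_iff, ← map_sub] at hdiff
        have hℓdiff : (ℓ : ℤ) • Affine.Point.congrEquiv hW₀ (Affine.Point.map
            ((absoluteGaloisGroup.toAlgEquiv _ τ :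
              AlgebraicClosure (v.adicCompletion K) ≃ₐ[v.adicCompletion K]
                AlgebraicClosure (v.adicCompletion K)) :
              AlgebraicClosure (v.adicCompletion K) →ₐ[v.adicCompletion K]
                AlgebraicClosure (v.adicCompletion K)) R' - R') = 0 := by
          rw [← map_zsmul, smul_sub, hℓτR', hℓR', sub_self, map_zero]
        have hzero := hdiff.eq_zero_of_zsmul_eq_zero W₀ hℓw hℓdiff
        rw [map_sub, sub_eq_zero] at hzero
        exact (Affine.Point.congrEquiv hW₀).injective hzero
      have hQ'mem : Q' ∈ FixedPoints.addSubgroup H (geomPoints W) := fun m ↦ hQ'fix m m.2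
      have hFQ' : F ⟨Q', hQ'mem⟩ = Affine.Point.congrEquiv hW₀ R' := by
        rw [hFapply]
        exact congrArg _ hΦιQ'
      have hQ'A' : (⟨Q', hQ'mem⟩ : FixedPoints.addSubgroup H (geomPoints W)) ∈ A' := by
        rw [hA'mem, hFQ']
        exact hR'E₁.hasNonsingularReduction
      refine ⟨⟨_, hQ'A'⟩, ?_, ?_⟩
      · rw [hrapply]
        exact (hrn _).mpr (by rw [hF'coe]; change W₀.ReducesToZero (F ⟨Q', hQ'mem⟩); rw [hFQ']; exact hR'E₁)
      · apply Subtype.ext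
        apply Subtype.ext
        change ℓ • Q' = Pg
        apply pointsMapOfEmb_injective W ι
        rw [map_nsmul, hιQ', ← map_nsmul, ← natCast_zsmul, hℓR', AddEquiv.symm_apply_apply]
  -- **hr**: the image of `r` contains the `ℓ`-power torsion
  have hr : ∀ b : Additive (IsLocalRing.ResidueField w.integer)ˣ, ∀ n : ℕ, ℓ ^ n • b = 0 →
      b ∈ r.range := by
    intro b n hb
    obtain ⟨P₀, hP₀⟩ := hrn_surj b
    set S₀ := (Affine.Point.congrEquiv hW₀).symm
      (P₀ : (W₀.baseChange (AlgebraicClosure (v.adicCompletion K))).toAffine.Point) with hS₀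
    have hcS₀ : Affine.Point.congrEquiv hW₀ S₀ = P₀ := by rw [hS₀, AddEquiv.apply_symm_apply]
    have hS₀E₀ : W₀.HasNonsingularReduction (Affine.Point.congrEquiv hW₀ S₀) := by
      rw [hcS₀]; exact P₀.2
    -- `ℓ^n • S₀ ∈ E₁`
    have hker : W₀.ReducesToZero (Affine.Point.congrEquiv hW₀ ((ℓ ^ n : ℕ) • S₀)) := by
      have h1 : rn ((ℓ ^ n : ℕ) • P₀) = 0 := by rw [map_nsmul, hP₀, hb]
      have h2 := (hrn _).mp h1
      rwa [AddSubgroup.coe_nsmul, ← hcS₀, ← map_nsmul] at h2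
    -- a torsion point `P₁ ∈ E₀` with `rn`-image `b`
    obtain ⟨P₁, hP₁E₀, hP₁tors, hP₁img⟩ :
        ∃ P₁ : ((W.localMinimalModel v).baseChange (AlgebraicClosure (v.adicCompletion K))).toAffine.Point,
          ∃ hE₀ : W₀.HasNonsingularReduction (Affine.Point.congrEquiv hW₀ P₁),
            (ℓ ^ n : ℕ) • P₁ = 0 ∧ rn ⟨Affine.Point.congrEquiv hW₀ P₁, hE₀⟩ = b := by
      rcases hT : ((ℓ ^ n : ℕ) • S₀) with _ | ⟨x, y, hxy⟩
      · refine ⟨S₀, hS₀E₀, by rw [hT, Affine.Point.zero_def], ?_⟩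
        rw [← hP₀]; congr 1; exact Subtype.ext hcS₀
      · have hx : 1 < w x := by
          rw [hT, Affine.Point.congrEquiv_some, reducesToZero_some_iff, not_mem_range_iff hv0] at hker
          exact hker
        obtain ⟨x', y', hxy', hx', hdivpt⟩ := exists_zsmul_eq_of_one_lt_val (w := w)
          (V := (W.localMinimalModel v).baseChange (AlgebraicClosure (v.adicCompletion K)))
          (m := ((ℓ ^ n : ℕ) : ℤ)) (hℓnw n) hxy hx
        set Q₁ : ((W.localMinimalModel v).baseChange (AlgebraicClosure (v.adicCompletion K))).toAffine.Point :=
          .some x' y' hxy' with hQ₁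
        have hQ₁E₁ : W₀.ReducesToZero (Affine.Point.congrEquiv hW₀ Q₁) := by
          rw [hQ₁, Affine.Point.congrEquiv_some, reducesToZero_some_iff, not_mem_range_iff hv0]
          exact hx'
        have hE₀' : W₀.HasNonsingularReduction (Affine.Point.congrEquiv hW₀ (S₀ - Q₁)) := by
          rw [map_sub]
          exact (W₀.nonsingularReductionSubgroup hv0).sub_mem hS₀E₀ hQ₁E₁.hasNonsingularReduction
        have hdivpt' : ((ℓ ^ n : ℕ) : ℤ) • Q₁ = Affine.Point.some x y hxy := by
          rw [hQ₁]; exact hdivpt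
        refine ⟨S₀ - Q₁, hE₀', ?_, ?_⟩
        · rw [nsmul_sub, hT, ← natCast_zsmul (Q₁), hdivpt', sub_self]
        · have hsplit : (⟨Affine.Point.congrEquiv hW₀ (S₀ - Q₁), hE₀'⟩ :
              W₀.nonsingularReductionSubgroup hv0) =
              ⟨Affine.Point.congrEquiv hW₀ S₀, hS₀E₀⟩ -
                ⟨Affine.Point.congrEquiv hW₀ Q₁, hQ₁E₁.hasNonsingularReduction⟩ :=
            Subtype.ext (by
              change Affine.Point.congrEquiv hW₀ (S₀ - Q₁) =
                Affine.Point.congrEquiv hW₀ S₀ - Affine.Point.congrEquiv hW₀ Q₁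
              rw [map_sub])
          rw [hsplit, map_sub,
            (hrn ⟨Affine.Point.congrEquiv hW₀ Q₁, hQ₁E₁.hasNonsingularReduction⟩).mpr hQ₁E₁,
            sub_zero, ← hP₀]
          congr 1; exact Subtype.ext hcS₀
    -- `P₁` comes from `E(K̄)[ℓ^n]`
    obtain ⟨P₂, -, hP₂⟩ := exists_pointsMapOfEmb_eq_of_nsmul_eq_zero W ι (m := ℓ ^ n)
      (pow_ne_zero n (Fact.out : ℓ.Prime).ne_zero) (Q := Φ.symm P₁)
      (by rw [← map_nsmul, hP₁tors, map_zero])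
    have hΦP₂ : Φ (pointsMapOfEmb W ι P₂) = P₁ := by rw [hP₂, AddEquiv.apply_symm_apply]
    -- `P₂` is fixed by `I_𝔓`
    have hP₂fix : ∀ σ ∈ H, σ • P₂ = P₂ := by
      intro σ hσ
      obtain ⟨τ, hτI, hres⟩ := hlift hσ
      obtain ⟨hτ₁, hτ₂⟩ := isometry_of_mem_inertia hw h𝔐 hτI
      apply pointsMapOfEmb_injective W ι
      rw [← hres, pointsMapOfEmb_smul]
      apply Φ.injective
      rw [hΦ τ, hΦP₂]
      have hE₀τ := (W₀.hasNonsingularReduction_congrEquiv_map_iff hW₀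
        ((absoluteGaloisGroup.toAlgEquiv _ τ :
            AlgebraicClosure (v.adicCompletion K) ≃ₐ[v.adicCompletion K]
              AlgebraicClosure (v.adicCompletion K)) :
            AlgebraicClosure (v.adicCompletion K) →ₐ[v.adicCompletion K]
              AlgebraicClosure (v.adicCompletion K)) hτ₁ hτ₂ P₁).mpr hP₁E₀
      have hred := W₀.reducePoint_congrEquiv_map_eq hW₀
        ((absoluteGaloisGroup.toAlgEquiv _ τ :
            AlgebraicClosure (v.adicCompletion K) ≃ₐ[v.adicCompletion K]
              AlgebraicClosure (v.adicCompletion K)) :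
            AlgebraicClosure (v.adicCompletion K) →ₐ[v.adicCompletion K]
              AlgebraicClosure (v.adicCompletion K)) hτ₁ hτ₂ P₁
      have key := W₀.eq_of_reducePoint_eq_of_zsmul_eq_zero (hℓnw n) hE₀τ hP₁E₀
        (by rw [← map_zsmul, ← map_zsmul, natCast_zsmul, hP₁tors, map_zero, map_zero])
        (by rw [← map_zsmul, natCast_zsmul, hP₁tors, map_zero]) hred
      exact (Affine.Point.congrEquiv hW₀).injective key
    have hP₂mem : P₂ ∈ FixedPoints.addSubgroup H (geomPoints W) := fun m ↦ hP₂fix m m.2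
    have hFP₂ : F ⟨P₂, hP₂mem⟩ = Affine.Point.congrEquiv hW₀ P₁ := by
      rw [hFapply]; exact congrArg _ hΦP₂
    have hP₂A' : (⟨P₂, hP₂mem⟩ : FixedPoints.addSubgroup H (geomPoints W)) ∈ A' := by
      rw [hA'mem, hFP₂]; exact hP₁E₀
    refine ⟨⟨_, hP₂A'⟩, ?_⟩
    rw [hrapply, ← hP₁img]
    congr 1
    exact Subtype.ext (by rw [hF'coe]; exact hFP₂)
  exact W.codimFixed_inertia_rationalTate_eq_one_of_reduction_of_finrank_le_one ℓ hℓk h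
    (v.primeBelow ι 𝔐) A' hle r hr htf hdiv


/-- **Thm. IV.10.2(a), multiplicative case, unconditionally, at every prime `𝔓 ∣ v`**
(transitivity of `Γ_K` on the primes above `v` and `primeBelow_comp`).
[cite: SilvermanATAEC1994, Thm. IV.10.2(a), multiplicative case, and its proof (PDF pp. 358–359)] -/
theorem codimFixed_inertia_rationalTate_eq_one_of_hasMultiplicativeReductionAt_at [W.IsElliptic]
    (h : Continuous fun x : absoluteGaloisGroup K × RationalTateModule (geomPoints W) ℓ ↦
      rationalTateRepresentation (absoluteGaloisGroup K) (geomPoints W) ℓ x.1 x.2)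
    (hℓ : (ℓ : 𝓞 K) ∉ v.asIdeal) (hmult : W.HasMultiplicativeReductionAt v)
    {𝔓 : Ideal (absIntegers (𝓞 K) K)} (h𝔓 : 𝔓 ∈ v.primesAbove) :
    (rationalTateGaloisRepOf (geomPoints W) ℓ h).codimFixed (𝔓.inertia (absoluteGaloisGroup K)) =
      1 := by
  obtain ⟨𝔐, h𝔐⟩ := v.localPrimesAbove_nonempty
  obtain ⟨g, hg⟩ := HeightOneSpectrum.exists_smul_eq_of_mem_primesAbove_holds
    (HeightOneSpectrum.primeBelow_mem_primesAbove
      (ι := closureEmb (K := K) (v.adicCompletion K)) h𝔐) h𝔓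
  have h1 : 𝔓 = v.primeBelow ((closureEmb (K := K) (v.adicCompletion K)).comp
      ((show AlgebraicClosure K ≃ₐ[K] AlgebraicClosure K from g⁻¹) :
        AlgebraicClosure K →ₐ[K] AlgebraicClosure K)) 𝔐 := by
    rw [HeightOneSpectrum.primeBelow_comp, ← hg]
    exact congrArg (· • _) (inv_inv g).symm
  rw [h1]
  exact W.codimFixed_inertia_rationalTate_eq_one_of_hasMultiplicativeReductionAt_primeBelow
    ℓ h hℓ hmult _ h𝔐

/-- **The named fact `codimFixed_inertia_rationalTate_eq_one_of_hasMultiplicativeReductionAt W ℓ`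
(Silverman *ATAEC* Thm. IV.10.2(a), multiplicative case) is a theorem.**
[cite: SilvermanATAEC1994, Thm. IV.10.2(a), multiplicative case (PDF pp. 358–360)] -/
theorem codimFixed_inertia_rationalTate_eq_one_of_hasMultiplicativeReductionAt_holds :
    W.codimFixed_inertia_rationalTate_eq_one_of_hasMultiplicativeReductionAt ℓ := by
  intro _ h v hℓ hv 𝔓 h𝔓
  exact W.codimFixed_inertia_rationalTate_eq_one_of_hasMultiplicativeReductionAt_at ℓ h hℓ hv h𝔓

/-! ### Consequences: Thm. IV.10.2(b) at the multiplicative places and for `p ≥ 5`, 10.2(a) from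
its additive case, the C15 fact for semistable curves -/

/-- **The named fact `swanConductorAt_rationalTate_eq_zero_of_hasMultiplicativeReductionAt W ℓ`
(Silverman *ATAEC* Thm. IV.10.2(b) at the multiplicative places: `Sw_𝔓(V_ℓ E) = 0`) is a
theorem**: unipotent inertia is tame once `codim (V_ℓ E)^{I_𝔓} = 1`
(`swanConductorAt_rationalTate_eq_zero_of_hasMultiplicativeReductionAt_of_codim`,
`BSDConductorSemistableProofs`, with the Weil pairing), and the latter is now a theorem.
[cite: SilvermanATAEC1994, Thm. IV.10.2(b), multiplicative case (PDF pp. 358–360)] -/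
theorem swanConductorAt_rationalTate_eq_zero_of_hasMultiplicativeReductionAt_holds :
    W.swanConductorAt_rationalTate_eq_zero_of_hasMultiplicativeReductionAt ℓ :=
  W.swanConductorAt_rationalTate_eq_zero_of_hasMultiplicativeReductionAt_of_codim ℓ
    (W.codimFixed_inertia_rationalTate_eq_one_of_hasMultiplicativeReductionAt_holds ℓ)

/-- **The named fact `swanConductorAt_rationalTate_eq_zero_of_ringChar_ne W ℓ` (Silverman
*ATAEC* Thm. IV.10.2(b), clause `p ≥ 5`: `Sw_𝔓(V_ℓ E) = 0` at every place `v ∤ 6ℓ`) is a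
theorem**: its reduction to the multiplicative case of 10.2(a) for the curves over `K`
(`swanConductorAt_rationalTate_eq_zero_of_ringChar_ne_of_codim`, `HasseWeilAbelianTameNegativeJProofs`:
potential good reduction for `v(j) ≥ 0`, a quadratic twist with multiplicative reduction for
`v(j) < 0`) is fed with `codimFixed_inertia_rationalTate_eq_one_of_hasMultiplicativeReductionAt_holds`.
[cite: SilvermanATAEC1994, Thm. IV.10.2(b), clause p ≥ 5, and its proof (PDF pp. 358–362)] -/
theorem swanConductorAt_rationalTate_eq_zero_of_ringChar_ne_holds :
    W.swanConductorAt_rationalTate_eq_zero_of_ringChar_ne ℓ :=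
  W.swanConductorAt_rationalTate_eq_zero_of_ringChar_ne_of_codim ℓ
    fun X ↦ X.codimFixed_inertia_rationalTate_eq_one_of_hasMultiplicativeReductionAt_holds ℓ

/-- **Silverman *ATAEC* Thm. IV.10.2(a) (`codim (V_ℓ E)^{I_𝔓} = ε_v`) from its additive case
alone** (`hTa`; the good case is a theorem, `HasseWeilAbelianConductorProofs`, and the
multiplicative case is `codimFixed_inertia_rationalTate_eq_one_of_hasMultiplicativeReductionAt_holds`).
[cite: SilvermanATAEC1994, Thm. IV.10.2(a) (PDF pp. 358–359)] -/
theorem codimFixed_inertia_rationalTate_eq_tameConductorExponent_of_add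
    (hTa : W.codimFixed_inertia_rationalTate_eq_two_of_hasAdditiveReductionAt ℓ) :
    W.codimFixed_inertia_rationalTate_eq_tameConductorExponent ℓ :=
  W.codimFixed_inertia_rationalTate_eq_tameConductorExponent_of_mult_of_add ℓ
    (W.codimFixed_inertia_rationalTate_eq_one_of_hasMultiplicativeReductionAt_holds ℓ) hTa

/-- **The additive case of Thm. IV.10.2(a) from Kodaira–Néron at the additive places only**: the
named fact `codimFixed_inertia_rationalTate_eq_two_of_hasAdditiveReductionAt W ℓ` follows from
`kodairaNeron_exists_finset_reducesToNonsingular` for the minimal models `W.localMinimalModel v` at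
the places `v` of *additive* reduction (`InertiaInvariantsKodairaNeronAdditiveProofs`, `…_at`);
after this file nothing is asked of Kodaira–Néron at the multiplicative places.
[cite: SilvermanATAEC1994, Thm. IV.10.2(a), additive case (PDF p. 358), with Cor. IV.9.2(d)] -/
theorem codimFixed_inertia_rationalTate_eq_two_of_hasAdditiveReductionAt_of_kodairaNeron_additive
    (hKN : ∀ v : HeightOneSpectrum (𝓞 K), W.HasAdditiveReductionAt v →
      (W.localMinimalModel v).kodairaNeron_exists_finset_reducesToNonsingular) :
    W.codimFixed_inertia_rationalTate_eq_two_of_hasAdditiveReductionAt ℓ := by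
  intro _ h v hℓ hv 𝔓 h𝔓
  exact W.codimFixed_inertia_rationalTate_eq_two_of_hasAdditiveReductionAt_of_kodairaNeron_at ℓ
    (hKN v hv) h hℓ hv h𝔓

/-- **The C15 fact for semistable curves, unconditionally** (Ogg–Saito in Galois form,
`a_v(V_ℓ E) = f_v(E)` at `v ∤ ℓ`, i.e. the named fact
`artinConductorExponent_tate_eq_conductorExponent_of_isElliptic W ℓ`, for `E/K` semistable):
Silverman *ATAEC* Thm. IV.10.2(a),(b) at the good and multiplicative places, all theorems now
(`artinConductorExponent_tate_eq_conductorExponent_of_isSemistable_of_codim`,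
`BSDConductorSemistableProofs`; Example 10.5, PDF p. 364: `𝔣(E/K) = ∏_{𝔭 ∣ 𝒟} 𝔭`).
[cite: SilvermanATAEC1994, Thm. IV.10.2(a),(b) and Example 10.5 (PDF pp. 358–364)] -/
theorem artinConductorExponent_tate_eq_conductorExponent_of_isSemistable
    (hs : W.IsSemistable (𝓞 K)) :
    W.artinConductorExponent_tate_eq_conductorExponent_of_isElliptic ℓ :=
  W.artinConductorExponent_tate_eq_conductorExponent_of_isSemistable_of_codim ℓ hs
    (W.codimFixed_inertia_rationalTate_eq_one_of_hasMultiplicativeReductionAt_holds ℓ)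

/-- **The C15 fact from the additive case of Thm. IV.10.2(a) for `E` and Ogg–Saito at `p = 2, 3`
only** (`hTa`, `hW23`): the multiplicative inputs of
`artinConductorExponent_tate_eq_conductorExponent_of_isElliptic_of_codim_of_ringChar_eq`
(`HasseWeilAbelianTameNegativeJProofs`) are theorems now.
[cite: SilvermanATAEC1994, Thm. IV.10.2, its proof, and proof of Thm. IV.11.1 (PDF pp. 358–366)] -/
theorem artinConductorExponent_tate_eq_conductorExponent_of_isElliptic_of_add_of_ringChar_eq
    (hTa : W.codimFixed_inertia_rationalTate_eq_two_of_hasAdditiveReductionAt ℓ)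
    (hW23 : W.swanConductorAt_rationalTate_eq_wildConductorExponent_of_ringChar_eq ℓ) :
    W.artinConductorExponent_tate_eq_conductorExponent_of_isElliptic ℓ :=
  W.artinConductorExponent_tate_eq_conductorExponent_of_isElliptic_of_codim_of_ringChar_eq ℓ
    (fun X ↦ X.codimFixed_inertia_rationalTate_eq_one_of_hasMultiplicativeReductionAt_holds ℓ)
    hTa hW23

end NumberField

end WeierstrassCurve

/-! ### Over `ℚ`: bsd.S15 -/

namespace Literature.NumberTheory.EllipticCurves

open WeierstrassCurve NumberField IsDedekindDomain

variable (W : WeierstrassCurve ℚ) (ℓ : ℕ) [Fact ℓ.Prime]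

/-- **bsd.S15 for a semistable elliptic `E/ℚ`, unconditionally**: the schema
`conductorNorm_eq_artinConductorNat W ℓ` (`N_E = N^{(ℓ)}(V_ℓ E)` for `ℓ ∤ N_E`; Silverman
*ATAEC* §IV.10, Definition of the conductor, PDF p. 364, with Thm. IV.10.2 and Example 10.5) at a
semistable elliptic `W`, by `conductorNorm_eq_artinConductorNat_of_isSemistable_of_codim`
(`BSDConductorSchemaProofs`) fed with
`codimFixed_inertia_rationalTate_eq_one_of_hasMultiplicativeReductionAt_holds`.  No hypothesis is
left: for semistable curves over `ℚ` the fact `conductorNorm_eq_artinConductorNat` is proved.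
[cite: SilvermanATAEC1994, §IV.10 Definition of the conductor (PDF p. 364) with Thm. IV.10.2(a),(b) and Example 10.5 (pp. 358–364)] -/
theorem conductorNorm_eq_artinConductorNat_of_isSemistable [W.IsElliptic]
    (hs : W.IsSemistable (𝓞 ℚ)) : conductorNorm_eq_artinConductorNat W ℓ :=
  conductorNorm_eq_artinConductorNat_of_isSemistable_of_codim W ℓ hs
    (W.codimFixed_inertia_rationalTate_eq_one_of_hasMultiplicativeReductionAt_holds ℓ)

/-- **bsd.S15 for an elliptic `E/ℚ` from the additive case of Thm. IV.10.2(a) for `E` and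
Ogg–Saito at `p = 2, 3`** (`hTa`, `hW23`), by `conductorNorm_eq_artinConductorNat_of_codim_of_ringChar_eq`
(`HasseWeilAbelianTameNegativeJProofs`) fed with the multiplicative case, a theorem for every
curve over `ℚ`.
[cite: SilvermanATAEC1994, §IV.10 Definition of the conductor (PDF p. 364) with Thm. IV.10.2 and proof of Thm. IV.11.1 (pp. 358–366)] -/
theorem conductorNorm_eq_artinConductorNat_of_add_of_ringChar_eq [W.IsElliptic]
    (hTa : W.codimFixed_inertia_rationalTate_eq_two_of_hasAdditiveReductionAt ℓ)
    (hW23 : W.swanConductorAt_rationalTate_eq_wildConductorExponent_of_ringChar_eq ℓ) :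
    conductorNorm_eq_artinConductorNat W ℓ :=
  conductorNorm_eq_artinConductorNat_of_codim_of_ringChar_eq W ℓ
    (fun X ↦ X.codimFixed_inertia_rationalTate_eq_one_of_hasMultiplicativeReductionAt_holds ℓ)
    hTa hW23

/-- **bsd.S15 for an elliptic `E/ℚ` from Kodaira–Néron at the additive places of `E` and
Ogg–Saito at `p = 2, 3`** — after this file the trust base of the schema
`conductorNorm_eq_artinConductorNat W ℓ` at an elliptic `W` is: the finiteness of
`E(ℚ_p^nr)/E₀(ℚ_p^nr)` for the minimal models at the primes `p` of *additive* reduction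
(*ATAEC* Cor. IV.9.2(d), Tate's algorithm) and Ogg's formula at `p = 2, 3` (*ATAEC* 11.1, Ogg /
Saito); for semistable `E` nothing (`conductorNorm_eq_artinConductorNat_of_isSemistable`).
[cite: SilvermanATAEC1994, §IV.10 Definition of the conductor (PDF p. 364) with Thm. IV.10.2, Cor. IV.9.2(d) and Thm. IV.11.1 (pp. 340–366)] -/
theorem conductorNorm_eq_artinConductorNat_of_kodairaNeron_additive_of_ringChar_eq [W.IsElliptic]
    (hKN : ∀ v : HeightOneSpectrum (𝓞 ℚ), W.HasAdditiveReductionAt v →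
      (W.localMinimalModel v).kodairaNeron_exists_finset_reducesToNonsingular)
    (hW23 : W.swanConductorAt_rationalTate_eq_wildConductorExponent_of_ringChar_eq ℓ) :
    conductorNorm_eq_artinConductorNat W ℓ :=
  conductorNorm_eq_artinConductorNat_of_add_of_ringChar_eq W ℓ
    (W.codimFixed_inertia_rationalTate_eq_two_of_hasAdditiveReductionAt_of_kodairaNeron_additive ℓ
      hKN) hW23

end Literature.NumberTheory.EllipticCurves

end
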